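import Literature.NumberTheory.EllipticCurves.Rank1Residual.GVParityTwistProofs
import Literature.NumberTheory.QuadraticFields.HeegnerCondition
import Literature.NumberTheory.QuadraticFields.FundamentalDiscriminant
import Literature.NumberTheory.EllipticCurves.HeegnerPointsImaginaryQuadraticProofs
import Literature.NumberTheory.EllipticCurves.KummerMap
import Literature.NumberTheory.EllipticCurves.QuadraticTwistProofs
import Literature.NumberTheory.EllipticCurves.PAdicGrossZagierConstantTermProofs
import Summits.BirchSwinnertonDyer.BirchSwinnertonDyer.Theorems.GenusKolyvaginAtTwoGenusPrimitiveSupplyAtTwoHeegnerTwinTamagawaOdd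
import Summits.BirchSwinnertonDyer.BirchSwinnertonDyer.Theorems.GenusKolyvaginAtTwoEquivariantKolyvaginExactAtTwoLocalDualityOrder
import HarnessLib

/-!
# Route `GenusKolyvaginAtTwo`, LINE 6, KEY crux Q3 `EquivariantKolyvaginExactAtTwo`
# (stmt-BirchSwinnertonDyer-24882): THE TWIN `E^{(d_K)}` SHARES THE GROSS–KOLYVAGIN PRIMES OF `E`

Helper (seat `bsd-line-gk2-p3` g11, cell `bsd-f1-sign2`; `--supports` the item, closes nothing). In the
eigen/`ℚ` architecture of Q3 (this lineage, memo `Q3-KERNEL-EIGEN-v2`: McCallum §5 at `p = 2` run over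
`ℚ` for `E` and for its twin `E^K = E^{(d_K)}` separately, the `τ = ±1` parts of `H¹(K, E[2^M])` being
`H¹(ℚ, E[2^M])` and `H¹(ℚ, E^K[2^M])`), every local input at a Kolyvagin prime `ℓ` is needed for BOTH
curves. The `+` side is in the tree (`…ReductionCyclic`, `…LocalTorsionCount`, `…LocalDualityOrder`:
`#E(ℚ_ℓ)[2^M] = 2^M`, cyclic, `#H¹(ℚ_ℓ, E[2^M]) = 4^M`, …, all under `FrobEqFrobInfty W K 2 ℓ`); the
`−` side was "left to the consumer". This file proves that nothing new is needed: **a Gross–Kolyvagin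
prime of `(E, K)` is a Gross–Kolyvagin prime of `(E^{(d_K)}, K)`, at every depth.**

* §1 `frobEqFrobInfty_iff_of_smul_quadraticTwist_eq` — for `E/ℚ`, `K` imaginary quadratic and ANY
  model `Wd` of the twist by `d_K` (`C • W.quadraticTwist d_K = Wd`), and every level `n`:
  `FrobEqFrobInfty W K n ℓ ↔ FrobEqFrobInfty Wd K n ℓ`. Mechanism (Silverman X.5.4): along the twist
  isomorphism `F : E^{(d)}(ℚ̄) ≃ E(ℚ̄)`, `F(σP) = χ_d(σ)·σF(P)` with `χ_d(σ) = σ√d/√d`; the witnesses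
  `h = Frob_𝔓` and `c₀` (complex conjugation) of `FrobEqFrobInfty` agree on `K = ℚ(√d_K)` by
  definition, and `c₀√d_K = −√d_K` because `d_K < 0`; so BOTH are `χ`-odd and `h = c₀` on `E[n]`
  transports to `h = c₀` on `E^{(d)}[n]`.
* §1 also records the two sign facts: `smul_geomSqrt_discr_eq_neg_of_frobEqFrobInfty_witness`
  (and §0 the signed twist isomorphism for an ARBITRARY model of the twist).
* §2 `kolyvaginIndex_eq_of_smul_quadraticTwist_eq`, `isKolyvaginPrime_two_iff_of_smul_quadraticTwist_eq` —
  Zhang's index `M(ℓ) = min(v₂(ℓ+1), v₂(a_ℓ))` and Zhang's Kolyvagin-prime predicate (the one the route's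
  items use) agree for `E` and any globally minimal `E′ ≅ E^{(d_K)}` (`d_K` odd): `a_ℓ(E′) = (d_K/ℓ) a_ℓ(E)`
  by the tree's PROVED `frobeniusTrace_quadraticTwist`.
* §3 the twin at a Gross–Kolyvagin prime `ℓ` of `(E, K)` of index `≥ M` (`Δ(E) < 0`, `d_K` odd): `Δ(E′) < 0`,
  good reduction at `ℓ`, and McCallum's Lemma 5.3 numerics for `E′` over `ℚ_ℓ` —
  `#E′(ℚ_ℓ)[2^M] = 2^M` and CYCLIC, `#H¹(ℚ_ℓ, E′[2^M]) = 4^M`, `#H¹(ℚ_ℓ, E′)[2^M] = 2^M`,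
  `[E′(ℚ_ℓ) : 2^M] = #𝓛_ℓ(E′) = 2^M` (the tree's `+`-side theorems fed with §1–§3).

Everything is PROVED from tree theorems (no named fact, no definition, no `sorry`, standard axioms). BSD is
not proved by this file; it is Galois bookkeeping for the crux's local stubs S2/S3 (twin side).

References: [SilvermanAEC2009] X.2 Prop. 2.4, X.5 Cor. 5.4; [GrossLMS1991] §3; [McCallumLMS1991] §5 Lemma 5.3.
-/

set_option autoImplicit false
set_option linter.dupNamespace false -- tree convention: `Summit.BirchSwinnertonDyer.BirchSwinnertonDyer.Theorems` (summit = sub-problem)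

noncomputable section

open scoped Classical

namespace Summit.BirchSwinnertonDyer.BirchSwinnertonDyer.Theorems.GenusExact.TwinGrossPrimes

open WeierstrassCurve NumberField IsDedekindDomain Field
open Literature.NumberTheory.EllipticCurves Literature.NumberTheory.GaloisRepresentations
open Literature.NumberTheory.EllipticCurves.Rank1Residual

universe u

/-! ## §0 The signed twist isomorphism for an arbitrary model of the twist -/

section Signed

variable {F : Type u} [Field F] [NeZero (2 : F)]

/-- **`E′(F̄) ≃+ E(F̄)` with `F(σP) = σF(P)` if `σ√d = √d` and `F(σP) = −σF(P)` if `σ√d = −√d`, for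
EVERY model `W′` of the quadratic twist** (`C • W.quadraticTwist d = W′`, `d ≠ 0`): the tree's signed
isomorphism `exists_addEquiv_geomPoints_quadraticTwist_sign` for the model `W.quadraticTwist d`,
composed with the (equivariant) change-of-equation isomorphism `W′(F̄) ≃+ (W^{(d)})(F̄)`.
[cite: SilvermanAEC2009, X.5 Cor. 5.4 and X.2 Prop. 2.4] -/
theorem exists_addEquiv_geomPoints_sign_of_smul_quadraticTwist_eq (W W' : WeierstrassCurve F) {d : F}
    (hd : d ≠ 0) {C : VariableChange F} (hC : C • W.quadraticTwist d = W') :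
    ∃ f : W'.geomPoints ≃+ W.geomPoints,
      (∀ σ : absoluteGaloisGroup F, σ • geomSqrt d = geomSqrt d → ∀ P, f (σ • P) = σ • f P) ∧
      (∀ σ : absoluteGaloisGroup F, σ • geomSqrt d = -geomSqrt d → ∀ P, f (σ • P) = -(σ • f P)) := by
  obtain ⟨f, hfpos, hfneg⟩ := W.exists_addEquiv_geomPoints_quadraticTwist_sign hd
  have hC' : C⁻¹ • W' = W.quadraticTwist d := by rw [← hC, inv_smul_smul]
  let e₁ : W'.geomPoints ≃+ (C⁻¹ • W').geomPoints :=
    VariableChange.pointEquivBaseChange W' C⁻¹ (AlgebraicClosure F)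
  let e₂ : (C⁻¹ • W').geomPoints ≃+ (W.quadraticTwist d).geomPoints :=
    Affine.Point.congrEquiv (congrArg (fun Z : WeierstrassCurve F ↦ Z.baseChange (AlgebraicClosure F)) hC')
  have h₁ : ∀ (σ : absoluteGaloisGroup F) (P : W'.geomPoints), e₁ (σ • P) = σ • e₁ P := fun σ P ↦
    VariableChange.pointEquivBaseChange_map_algEquiv W' C⁻¹ (absoluteGaloisGroup.toAlgEquiv F σ) P
  have h₂ : ∀ (σ : absoluteGaloisGroup F) (P : (C⁻¹ • W').geomPoints), e₂ (σ • P) = σ • e₂ P :=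
    fun σ P ↦ congrEquiv_smul_of_eq hC' (absoluteGaloisGroup.toAlgEquiv F σ) P
  refine ⟨(e₁.trans e₂).trans f, fun σ hσ P ↦ ?_, fun σ hσ P ↦ ?_⟩
  · simp only [AddEquiv.trans_apply]
    rw [h₁, h₂, hfpos σ hσ]
  · simp only [AddEquiv.trans_apply]
    rw [h₁, h₂, hfneg σ hσ]

omit [NeZero (2 : F)] in
/-- An additive isomorphism of geometric points maps `n`-torsion to `n`-torsion. [folklore] -/
theorem map_mem_geomTorsion {W W' : WeierstrassCurve F} (f : W'.geomPoints ≃+ W.geomPoints) {n : ℤ}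
    {P : W'.geomPoints} (hP : P ∈ W'.geomTorsion n) : f P ∈ W.geomTorsion n := by
  rw [WeierstrassCurve.mem_geomTorsion_iff] at hP ⊢
  rw [← map_zsmul, hP, map_zero]

/-- **Transport of "`h = c₀` on the `n`-torsion" along a signed isomorphism**: if `h, c₀ ∈ Γ_F` both
negate `√d` and agree on `E[n]`, they agree on `E′[n]` for every model `E′` of `E^{(d)}`. [folklore] -/
theorem forall_smul_eq_smul_of_sign (W W' : WeierstrassCurve F) {d : F} (hd : d ≠ 0)
    {C : VariableChange F} (hC : C • W.quadraticTwist d = W') {h c₀ : absoluteGaloisGroup F}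
    (hh : h • geomSqrt d = -geomSqrt d) (hc₀ : c₀ • geomSqrt d = -geomSqrt d) {n : ℤ}
    (hagree : ∀ P : W.geomTorsion n, h • P = c₀ • P) :
    ∀ P : W'.geomTorsion n, h • P = c₀ • P := by
  obtain ⟨f, -, hfneg⟩ := exists_addEquiv_geomPoints_sign_of_smul_quadraticTwist_eq W W' hd hC
  intro P
  apply Subtype.ext
  apply f.injective
  rw [AddSubgroup.torsionBy.coe_smul, AddSubgroup.torsionBy.coe_smul, hfneg h hh, hfneg c₀ hc₀]
  have hmem : f (P : W'.geomPoints) ∈ W.geomTorsion n := map_mem_geomTorsion f P.2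
  have key := congrArg (fun Q : W.geomTorsion n ↦ (Q : W.geomPoints)) (hagree ⟨f P, hmem⟩)
  simp only [AddSubgroup.torsionBy.coe_smul] at key
  rw [key]

end Signed

/-! ## §1 `Frob(ℓ) = Frob(∞)` transfers from `E` to its twin by `d_K` -/

section Transfer

variable (W : WeierstrassCurve ℚ) (K : Type) [Field K] [NumberField K]

/-- **`√d_K ∈ e(K)` for every embedding `e : K → ℚ̄`**: some `δ ∈ K` has `e δ = √d_K` or `e δ = −√d_K`
(`δ² = d_K` in `𝓞 K`, Marcus Ch. 2 Thm. 1; the two square roots of `d_K` in `ℚ̄`). [folklore] -/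
theorem exists_embedding_eq_geomSqrt_discr (hK : IsImaginaryQuadratic K) (e : K →ₐ[ℚ] AlgebraicClosure ℚ) :
    ∃ δ : K, e δ = geomSqrt ((NumberField.discr K : ℤ) : ℚ) ∨ e δ = -geomSqrt ((NumberField.discr K : ℤ) : ℚ) := by
  obtain ⟨-, -, δ, -, hδ⟩ := Literature.NumberTheory.QuadraticFields.Quadratic.exists_sq_eq_discr hK.1
  refine ⟨algebraMap (𝓞 K) K δ, ?_⟩
  apply sq_eq_sq_iff_eq_or_eq_neg.mp
  have hδK : (algebraMap (𝓞 K) K δ) ^ 2 = algebraMap ℚ K ((NumberField.discr K : ℤ) : ℚ) := by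
    rw [← map_pow, hδ, map_intCast, map_intCast]
  rw [geomSqrt_sq, ← map_pow, hδK, AlgHom.commutes]
  simp

/-- **A witness pair `(h, c₀)` of `FrobEqFrobInfty W K n ℓ` negates `√d_K`** (`K` imaginary quadratic):
`c₀ √d_K = −√d_K` because `c₀` is a complex conjugation and `d_K < 0`
(`smul_geomSqrt_eq_neg_of_isComplexConjugation`), and `h √d_K = c₀ √d_K` because `h` and `c₀` agree on
`e(K) ∋ ±√d_K`. [cite: GrossLMS1991, §3 (3.2)] -/
theorem smul_geomSqrt_discr_eq_neg_of_frobEqFrobInfty_witness (hK : IsImaginaryQuadratic K)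
    {h c₀ : absoluteGaloisGroup ℚ} (hc₀ : IsComplexConjugation (Rat.castHom ℝ) c₀)
    (hhK : ∀ (e : K →ₐ[ℚ] AlgebraicClosure ℚ) (x : K), h • e x = c₀ • e x) :
    c₀ • geomSqrt ((NumberField.discr K : ℤ) : ℚ) = -geomSqrt ((NumberField.discr K : ℤ) : ℚ) ∧
      h • geomSqrt ((NumberField.discr K : ℤ) : ℚ) = -geomSqrt ((NumberField.discr K : ℤ) : ℚ) := by
  have hd : ((NumberField.discr K : ℤ) : ℚ) < 0 := by exact_mod_cast hK.discr_neg
  have hc : c₀ • geomSqrt ((NumberField.discr K : ℤ) : ℚ) = -geomSqrt ((NumberField.discr K : ℤ) : ℚ) :=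
    smul_geomSqrt_eq_neg_of_isComplexConjugation hd hc₀
  refine ⟨hc, ?_⟩
  haveI : Algebra.IsAlgebraic ℚ K := Algebra.IsAlgebraic.of_finite ℚ K
  let e : K →ₐ[ℚ] AlgebraicClosure ℚ := IsAlgClosed.lift
  obtain ⟨δ, hδ⟩ := exists_embedding_eq_geomSqrt_discr K hK e
  rcases hδ with hδ | hδ
  · rw [← hδ, hhK e δ, hδ, hc]
  · have h1 : h • e δ = c₀ • e δ := hhK e δ
    rw [hδ, smul_neg, smul_neg, neg_inj] at h1
    rw [h1, hc]

variable {K}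

/-- **A Gross–Kolyvagin prime of `(E, K)` is one of `(E′, K)` for every model `E′` of the twist
`E^{(d_K)}`, at every level `n`**: `FrobEqFrobInfty W K n ℓ → FrobEqFrobInfty Wd K n ℓ` whenever
`C • W.quadraticTwist d_K = Wd` (`K` imaginary quadratic). The witnesses `(v, 𝔓, h, c₀)` are kept; on
the torsion both `h` and `c₀` are `χ_{d_K}`-odd, so `h = c₀` on `E[n]` gives `h = c₀` on `E′[n]`
(`forall_smul_eq_smul_of_sign`). [cite: GrossLMS1991, §3 (3.2)] [cite: SilvermanAEC2009, X.5 Cor. 5.4] -/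
theorem frobEqFrobInfty_of_smul_quadraticTwist_eq (hK : IsImaginaryQuadratic K) (Wd : WeierstrassCurve ℚ)
    {C : VariableChange ℚ} (hC : C • W.quadraticTwist ((NumberField.discr K : ℤ) : ℚ) = Wd)
    {n ℓ : ℕ} (hℓ : FrobEqFrobInfty W K n ℓ) : FrobEqFrobInfty Wd K n ℓ := by
  obtain ⟨v, 𝔓, h, c₀, hℓv, h𝔓, hFrob, hc₀, hP, hKcl⟩ := hℓ
  have hd : ((NumberField.discr K : ℤ) : ℚ) ≠ 0 := by exact_mod_cast NumberField.discr_ne_zero K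
  obtain ⟨hcs, hhs⟩ := smul_geomSqrt_discr_eq_neg_of_frobEqFrobInfty_witness K hK hc₀ hKcl
  exact ⟨v, 𝔓, h, c₀, hℓv, h𝔓, hFrob, hc₀, forall_smul_eq_smul_of_sign W Wd hd hC hhs hcs hP, hKcl⟩

end Transfer

/-! ## §2 The Kolyvagin index and Zhang's Kolyvagin-prime predicate are shared by the twin -/

section Index

variable (W : WeierstrassCurve ℚ) [W.IsElliptic] [W.IsGloballyMinimal] {K : Type} [Field K] [NumberField K]

/-- **`d_K` odd ⟹ `d_K ≡ 1 (mod 4)` and `d_K` squarefree** (a quadratic discriminant is fundamental: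
`isFundamentalDiscriminant_discr`; the case `4 ∣ d_K` is excluded by oddness). [folklore] -/
theorem discr_emod_four_eq_one_and_squarefree_of_odd (h2 : Module.finrank ℚ K = 2)
    (hodd : Odd (NumberField.discr K)) :
    NumberField.discr K % 4 = 1 ∧ Squarefree (NumberField.discr K) := by
  rcases Literature.NumberTheory.QuadraticFields.Quadratic.isFundamentalDiscriminant_discr (K := K) h2 with
    ⟨h1, hsq, -⟩ | ⟨h4, -, -⟩
  · exact ⟨h1, hsq⟩
  · exfalso
    obtain ⟨k, hk⟩ := hodd
    obtain ⟨m, hm⟩ := h4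
    omega

/-- **`|a_ℓ(E^{(d_K)})| = |a_ℓ(E)|` at a prime `ℓ ∤ 2 d_K` of good reduction** (`a_ℓ(E′) = (d_K/ℓ)·a_ℓ(E)`,
the tree's PROVED `frobeniusTrace_quadraticTwist`, `d_K` squarefree as `d_K` is odd; `(d_K/ℓ) = ±1`).
Both curves globally minimal. [cite: SilvermanAEC2009, X.2 Prop. 2.4 and Exercise 10.16(c)] -/
theorem natAbs_frobeniusTrace_eq_of_smul_quadraticTwist_eq (h2 : Module.finrank ℚ K = 2)
    (hodd : Odd (NumberField.discr K)) (Wd : WeierstrassCurve ℚ) [Wd.IsGloballyMinimal]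
    {C : VariableChange ℚ} (hC : C • W.quadraticTwist ((NumberField.discr K : ℤ) : ℚ) = Wd)
    {ℓ : ℕ} [Fact ℓ.Prime] (hℓ2 : ℓ ≠ 2) (hℓd : ¬ ((ℓ : ℤ) ∣ NumberField.discr K))
    (hgood : W.HasGoodReductionAtPrime ℓ) :
    (Wd.frobeniusTrace ℓ).natAbs = (W.frobeniusTrace ℓ).natAbs := by
  have hℓ : ℓ.Prime := Fact.out
  have hsq := (discr_emod_four_eq_one_and_squarefree_of_odd (K := K) h2 hodd).2
  have hW' : ∃ C' : VariableChange ℚ, C' • Wd = W.quadraticTwist ((NumberField.discr K : ℤ) : ℚ) :=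
    ⟨C⁻¹, by rw [← hC, inv_smul_smul]⟩
  have h2d : ¬ ((ℓ : ℤ) ∣ 2 * NumberField.discr K) := by
    intro h
    rcases (Nat.prime_iff_prime_int.mp hℓ).dvd_or_dvd h with h | h
    · have h' : ℓ ∣ 2 := by exact_mod_cast h
      exact hℓ2 ((Nat.prime_dvd_prime_iff_eq hℓ Nat.prime_two).mp h')
    · exact hℓd h
  have hΔ := W.not_dvd_minimalDiscriminantInt_of_hasGoodReductionAtPrime ℓ hgood
  have htr := frobeniusTrace_quadraticTwist_holds W Wd (NumberField.discr K) hsq hW' ℓ h2d hΔ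
  rw [htr, Int.natAbs_mul]
  have hunit : (legendreSym ℓ (NumberField.discr K)).natAbs = 1 := by
    have hne : ((NumberField.discr K : ℤ) : ZMod ℓ) ≠ 0 := by
      rw [Ne, ZMod.intCast_zmod_eq_zero_iff_dvd]
      exact hℓd
    rcases legendreSym.eq_one_or_neg_one ℓ hne with h | h <;> simp [h]
  rw [hunit, one_mul]

/-- **The twin has the same Zhang–Kolyvagin index `M(ℓ) = min(v_p(ℓ+1), v_p(a_ℓ))`** at every prime
`ℓ ∤ 2 d_K` of good reduction, for every `p`. [cite: WZhang2014, Notations (xii)] -/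
theorem kolyvaginIndex_eq_of_smul_quadraticTwist_eq (h2 : Module.finrank ℚ K = 2)
    (hodd : Odd (NumberField.discr K)) (Wd : WeierstrassCurve ℚ) [Wd.IsGloballyMinimal]
    {C : VariableChange ℚ} (hC : C • W.quadraticTwist ((NumberField.discr K : ℤ) : ℚ) = Wd)
    {ℓ : ℕ} [Fact ℓ.Prime] (hℓ2 : ℓ ≠ 2) (hℓd : ¬ ((ℓ : ℤ) ∣ NumberField.discr K))
    (hgood : W.HasGoodReductionAtPrime ℓ) (p : ℕ) :
    Zhang2014.kolyvaginIndex Wd p ℓ = Zhang2014.kolyvaginIndex W p ℓ := by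
  unfold Zhang2014.kolyvaginIndex
  rw [natAbs_frobeniusTrace_eq_of_smul_quadraticTwist_eq W h2 hodd Wd hC hℓ2 hℓd hgood]

/-- **Zhang's Kolyvagin primes at `p = 2` are shared by the twin**: for `ℓ` of good reduction for `E`,
`IsKolyvaginPrime N E^{(d_K)} K 2 ℓ ↔ IsKolyvaginPrime N E K 2 ℓ` (the predicate sees the curve only
through `M(ℓ)`; `ℓ ≠ 2` and `ℓ ∤ d_K` are part of it). [cite: WZhang2014, Notations (xii)] -/
theorem isKolyvaginPrime_two_iff_of_smul_quadraticTwist_eq (h2 : Module.finrank ℚ K = 2)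
    (hodd : Odd (NumberField.discr K)) (Wd : WeierstrassCurve ℚ) [Wd.IsGloballyMinimal]
    {C : VariableChange ℚ} (hC : C • W.quadraticTwist ((NumberField.discr K : ℤ) : ℚ) = Wd)
    (N : ℕ) {ℓ : ℕ} [Fact ℓ.Prime] (hgood : W.HasGoodReductionAtPrime ℓ) :
    Zhang2014.IsKolyvaginPrime N Wd K 2 ℓ ↔ Zhang2014.IsKolyvaginPrime N W K 2 ℓ := by
  constructor
  · rintro ⟨hℓ, hN, hD, hℓ2, hprime, hidx⟩
    refine ⟨hℓ, hN, hD, hℓ2, hprime, ?_⟩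
    rwa [kolyvaginIndex_eq_of_smul_quadraticTwist_eq W h2 hodd Wd hC hℓ2 hD hgood 2] at hidx
  · rintro ⟨hℓ, hN, hD, hℓ2, hprime, hidx⟩
    refine ⟨hℓ, hN, hD, hℓ2, hprime, ?_⟩
    rwa [kolyvaginIndex_eq_of_smul_quadraticTwist_eq W h2 hodd Wd hC hℓ2 hD hgood 2]

end Index

/-! ## §3 The twin at a Gross–Kolyvagin prime: `Δ < 0`, good reduction, and McCallum's local numerics -/

section Twin

variable (W : WeierstrassCurve ℚ) [W.IsElliptic] [W.IsGloballyMinimal] {K : Type} [Field K] [NumberField K]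

omit [W.IsElliptic] [W.IsGloballyMinimal] in
/-- **The twin keeps the sign of the discriminant**: `C • W^{(d)} = Wd`, `d ≠ 0`, `Δ(W) < 0 ⟹ Δ(Wd) < 0`
(`Δ(W^{(d)}) = d⁶Δ(W)`, `Δ(C • V) = u⁻¹²Δ(V)`). [cite: SilvermanAEC2009, X.5 Cor. 5.4 and III.1 Table 3.1] -/
theorem Δ_neg_of_smul_quadraticTwist_eq {d : ℚ} (hd : d ≠ 0) (Wd : WeierstrassCurve ℚ)
    {C : VariableChange ℚ} (hC : C • W.quadraticTwist d = Wd) (hΔ : W.Δ < 0) : Wd.Δ < 0 := by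
  rw [← hC, variableChange_Δ, quadraticTwist_Δ]
  have hu : (0 : ℚ) < (C.u⁻¹ : ℚˣ) ^ 12 := by
    rw [show (12 : ℕ) = 2 * 6 from rfl, pow_mul]
    exact pow_pos (lt_of_le_of_ne (sq_nonneg _) (Ne.symm (pow_ne_zero 2 (Units.ne_zero _)))) 6
  have hd6 : (0 : ℚ) < d ^ 6 := by
    rw [show (6 : ℕ) = 2 * 3 from rfl, pow_mul]
    exact pow_pos (lt_of_le_of_ne (sq_nonneg _) (Ne.symm (pow_ne_zero 2 hd))) 3
  exact mul_neg_of_pos_of_neg hu (mul_neg_of_pos_of_neg hd6 hΔ)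

omit [W.IsGloballyMinimal] in
/-- **The twin has good reduction at every `ℓ ∤ d_K` of good reduction for `E`** (`d_K ≡ 1 (mod 4)` as
`d_K` is odd; the tree's `hasGoodReductionAtPrime_twist_of_not_dvd`, conductor exponents agree off `d_K`).
[cite: SilvermanATAEC1994, IV.9.4] -/
theorem hasGoodReductionAtPrime_of_smul_quadraticTwist_eq (h2 : Module.finrank ℚ K = 2)
    (hodd : Odd (NumberField.discr K)) (Wd : WeierstrassCurve ℚ) [Wd.IsElliptic]
    {C : VariableChange ℚ} (hC : C • W.quadraticTwist ((NumberField.discr K : ℤ) : ℚ) = Wd)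
    {ℓ : ℕ} [Fact ℓ.Prime] (hℓd : ¬ ((ℓ : ℤ) ∣ NumberField.discr K))
    (hgood : W.HasGoodReductionAtPrime ℓ) : Wd.HasGoodReductionAtPrime ℓ :=
  Summit.BirchSwinnertonDyer.BirchSwinnertonDyer.Theorems.GenusKolyTwin.hasGoodReductionAtPrime_twist_of_not_dvd
    W (discr_emod_four_eq_one_and_squarefree_of_odd (K := K) h2 hodd).1 C hC ℓ hgood hℓd

open Summit.BirchSwinnertonDyer.BirchSwinnertonDyer.Theorems.GenusExact.ReductionCyclic
open Summit.BirchSwinnertonDyer.BirchSwinnertonDyer.Theorems.GenusExact.LocalDualityOrder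

/-- **`#E′(ℚ_ℓ)[2^M] = 2^M` for the twin `E′ = E^{(d_K)}` at a Gross–Kolyvagin prime `ℓ` of `(E, K)` of
index `≥ M`** (`E` globally minimal with `Δ < 0`, `K` imaginary quadratic with `d_K` odd, `ℓ` odd of good
reduction for `E`, `ℓ ∤ d_K`, `Frob_ℓ ∼ Frob_∞` on `E[2]`; `E′` any globally minimal model of the twist):
the `−`-part of McCallum's Lemma 5.3 (i) at `p = 2`, read over `ℚ_ℓ` on the twin — §1–§3 feed the tree's
`+`-part theorem `natCard_ker_zsmul_adicCompletion_two_pow_eq` with `E′` in place of `E`.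
[cite: McCallumLMS1991, §5 Lemma 5.3] [cite: GrossLMS1991, §3 (3.2)–(3.3)] -/
theorem natCard_ker_zsmul_adicCompletion_two_pow_eq_twin (hK : IsImaginaryQuadratic K)
    (hodd : Odd (NumberField.discr K)) (hΔ : W.Δ < 0) (Wd : WeierstrassCurve ℚ) [Wd.IsElliptic]
    [Wd.IsGloballyMinimal] {C : VariableChange ℚ}
    (hC : C • W.quadraticTwist ((NumberField.discr K : ℤ) : ℚ) = Wd)
    {ℓ : ℕ} [Fact ℓ.Prime] (hℓ2 : ℓ ≠ 2) (hℓd : ¬ ((ℓ : ℤ) ∣ NumberField.discr K))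
    (hgoodℓ : W.HasGoodReductionAtPrime ℓ) (hℓ : FrobEqFrobInfty W K 2 ℓ)
    {v : HeightOneSpectrum (𝓞 ℚ)} (hv : (ℓ : 𝓞 ℚ) ∈ v.asIdeal) {M : ℕ}
    (hM : M ≤ Zhang2014.kolyvaginIndex W 2 ℓ) :
    Nat.card (zsmulAddGroupHom ((2 ^ M : ℕ) : ℤ) :
        (Wd.baseChange (v.adicCompletion ℚ)).toAffine.Point →+ _).ker = 2 ^ M := by
  have hd : ((NumberField.discr K : ℤ) : ℚ) ≠ 0 := by exact_mod_cast NumberField.discr_ne_zero K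
  exact natCard_ker_zsmul_adicCompletion_two_pow_eq Wd (Δ_neg_of_smul_quadraticTwist_eq W hd Wd hC hΔ) hℓ2
    (hasGoodReductionAtPrime_of_smul_quadraticTwist_eq W hK.1 hodd Wd hC hℓd hgoodℓ)
    (frobEqFrobInfty_of_smul_quadraticTwist_eq W hK Wd hC hℓ) hv
    (by rwa [kolyvaginIndex_eq_of_smul_quadraticTwist_eq W hK.1 hodd Wd hC hℓ2 hℓd hgoodℓ 2])

/-- **`E′(ℚ_ℓ)[2^M]` is cyclic of order `2^M`** for the twin at a Gross–Kolyvagin prime of `(E, K)` of index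
`≥ M` (hypotheses as above): McCallum's Lemma 5.3 (i), `−` part, over `ℚ_ℓ` at `2`.
[cite: McCallumLMS1991, §5 Lemma 5.3] -/
theorem isAddCyclic_ker_zsmul_adicCompletion_two_pow_twin (hK : IsImaginaryQuadratic K)
    (hodd : Odd (NumberField.discr K)) (hΔ : W.Δ < 0) (Wd : WeierstrassCurve ℚ) [Wd.IsElliptic]
    [Wd.IsGloballyMinimal] {C : VariableChange ℚ}
    (hC : C • W.quadraticTwist ((NumberField.discr K : ℤ) : ℚ) = Wd)
    {ℓ : ℕ} [Fact ℓ.Prime] (hℓ2 : ℓ ≠ 2) (hℓd : ¬ ((ℓ : ℤ) ∣ NumberField.discr K))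
    (hgoodℓ : W.HasGoodReductionAtPrime ℓ) (hℓ : FrobEqFrobInfty W K 2 ℓ)
    {v : HeightOneSpectrum (𝓞 ℚ)} (hv : (ℓ : 𝓞 ℚ) ∈ v.asIdeal) {M : ℕ}
    (hM : M ≤ Zhang2014.kolyvaginIndex W 2 ℓ) :
    IsAddCyclic (zsmulAddGroupHom ((2 ^ M : ℕ) : ℤ) :
        (Wd.baseChange (v.adicCompletion ℚ)).toAffine.Point →+ _).ker ∧
      Nonempty ((zsmulAddGroupHom ((2 ^ M : ℕ) : ℤ) :
        (Wd.baseChange (v.adicCompletion ℚ)).toAffine.Point →+ _).ker ≃+ ZMod (2 ^ M)) := by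
  have hd : ((NumberField.discr K : ℤ) : ℚ) ≠ 0 := by exact_mod_cast NumberField.discr_ne_zero K
  exact isAddCyclic_ker_zsmul_adicCompletion_two_pow Wd (Δ_neg_of_smul_quadraticTwist_eq W hd Wd hC hΔ) hℓ2
    (hasGoodReductionAtPrime_of_smul_quadraticTwist_eq W hK.1 hodd Wd hC hℓd hgoodℓ)
    (frobEqFrobInfty_of_smul_quadraticTwist_eq W hK Wd hC hℓ) hv
    (by rwa [kolyvaginIndex_eq_of_smul_quadraticTwist_eq W hK.1 hodd Wd hC hℓ2 hℓd hgoodℓ 2])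

/-- **`#H¹(ℚ_ℓ, E′[2^M]) = 4^M`** for the twin at a Gross–Kolyvagin prime of `(E, K)` of index `≥ M ≥ 1`
(the `−`-part of McCallum's "`H¹(K_λ, E_{p^M}) ≅ (ℤ/p^M)⁴`" at the `ℚ_ℓ`-level).
[cite: McCallumLMS1991, §5 Lemma 5.3] [cite: MilneADT2006, Ch. I, Thm. 2.8] -/
theorem natCard_galoisCohomology_one_two_pow_eq_twin (hK : IsImaginaryQuadratic K)
    (hodd : Odd (NumberField.discr K)) (hΔ : W.Δ < 0) (Wd : WeierstrassCurve ℚ) [Wd.IsElliptic]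
    [Wd.IsGloballyMinimal] {C : VariableChange ℚ}
    (hC : C • W.quadraticTwist ((NumberField.discr K : ℤ) : ℚ) = Wd)
    {ℓ : ℕ} [Fact ℓ.Prime] (hℓ2 : ℓ ≠ 2) (hℓd : ¬ ((ℓ : ℤ) ∣ NumberField.discr K))
    (hgoodℓ : W.HasGoodReductionAtPrime ℓ) (hℓ : FrobEqFrobInfty W K 2 ℓ)
    {v : HeightOneSpectrum (𝓞 ℚ)} (hv : (ℓ : 𝓞 ℚ) ∈ v.asIdeal) {M : ℕ} (hM0 : M ≠ 0)
    (hM : M ≤ Zhang2014.kolyvaginIndex W 2 ℓ) :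
    Nat.card (galoisCohomology
        (GaloisRep.restrictField (v.adicCompletion ℚ) (Wd.torsionGaloisModule ((2 ^ M : ℕ) : ℤ))) 1) =
      4 ^ M := by
  have hd : ((NumberField.discr K : ℤ) : ℚ) ≠ 0 := by exact_mod_cast NumberField.discr_ne_zero K
  exact natCard_galoisCohomology_one_two_pow_eq Wd (Δ_neg_of_smul_quadraticTwist_eq W hd Wd hC hΔ) hℓ2
    (hasGoodReductionAtPrime_of_smul_quadraticTwist_eq W hK.1 hodd Wd hC hℓd hgoodℓ)
    (frobEqFrobInfty_of_smul_quadraticTwist_eq W hK Wd hC hℓ) hv hM0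
    (by rwa [kolyvaginIndex_eq_of_smul_quadraticTwist_eq W hK.1 hodd Wd hC hℓ2 hℓd hgoodℓ 2])

/-- **`#H¹(ℚ_ℓ, E′)[2^M] = 2^M`** for the twin at a Gross–Kolyvagin prime of `(E, K)` of index `≥ M ≥ 1`
(McCallum's "`H¹(K_λ, E)_{p^M}^{−} ≅ ℤ/p^M`" over `ℚ_ℓ`). [cite: McCallumLMS1991, §5 Lemma 5.3] -/
theorem natCard_torsionBy_localH1_two_pow_eq_twin (hK : IsImaginaryQuadratic K)
    (hodd : Odd (NumberField.discr K)) (hΔ : W.Δ < 0) (Wd : WeierstrassCurve ℚ) [Wd.IsElliptic]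
    [Wd.IsGloballyMinimal] {C : VariableChange ℚ}
    (hC : C • W.quadraticTwist ((NumberField.discr K : ℤ) : ℚ) = Wd)
    {ℓ : ℕ} [Fact ℓ.Prime] (hℓ2 : ℓ ≠ 2) (hℓd : ¬ ((ℓ : ℤ) ∣ NumberField.discr K))
    (hgoodℓ : W.HasGoodReductionAtPrime ℓ) (hℓ : FrobEqFrobInfty W K 2 ℓ)
    {v : HeightOneSpectrum (𝓞 ℚ)} (hv : (ℓ : 𝓞 ℚ) ∈ v.asIdeal) {M : ℕ} (hM0 : M ≠ 0)
    (hM : M ≤ Zhang2014.kolyvaginIndex W 2 ℓ) :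
    Nat.card (AddSubgroup.torsionBy
        (galoisCohomology (Wd.localGaloisModule (v.adicCompletion ℚ)) 1) ((2 ^ M : ℕ) : ℤ)) =
      2 ^ M := by
  have hd : ((NumberField.discr K : ℤ) : ℚ) ≠ 0 := by exact_mod_cast NumberField.discr_ne_zero K
  exact natCard_torsionBy_localH1_two_pow_eq Wd (Δ_neg_of_smul_quadraticTwist_eq W hd Wd hC hΔ) hℓ2
    (hasGoodReductionAtPrime_of_smul_quadraticTwist_eq W hK.1 hodd Wd hC hℓd hgoodℓ)
    (frobEqFrobInfty_of_smul_quadraticTwist_eq W hK Wd hC hℓ) hv hM0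
    (by rwa [kolyvaginIndex_eq_of_smul_quadraticTwist_eq W hK.1 hodd Wd hC hℓ2 hℓd hgoodℓ 2])

/-- **`[E′(ℚ_ℓ) : 2^M E′(ℚ_ℓ)] = 2^M` and `#𝓛_ℓ(E′) = 2^M`** (local Kummer condition of the twin) at a
Gross–Kolyvagin prime of `(E, K)` of index `≥ M`. [cite: McCallumLMS1991, §5 Lemma 5.3] -/
theorem index_range_two_pow_eq_twin (hK : IsImaginaryQuadratic K)
    (hodd : Odd (NumberField.discr K)) (hΔ : W.Δ < 0) (Wd : WeierstrassCurve ℚ) [Wd.IsElliptic]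
    [Wd.IsGloballyMinimal] {C : VariableChange ℚ}
    (hC : C • W.quadraticTwist ((NumberField.discr K : ℤ) : ℚ) = Wd)
    {ℓ : ℕ} [Fact ℓ.Prime] (hℓ2 : ℓ ≠ 2) (hℓd : ¬ ((ℓ : ℤ) ∣ NumberField.discr K))
    (hgoodℓ : W.HasGoodReductionAtPrime ℓ) (hℓ : FrobEqFrobInfty W K 2 ℓ)
    {v : HeightOneSpectrum (𝓞 ℚ)} (hv : (ℓ : 𝓞 ℚ) ∈ v.asIdeal) {M : ℕ}
    (hM : M ≤ Zhang2014.kolyvaginIndex W 2 ℓ) :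
    (nsmulAddMonoidHom (2 ^ M) : (Wd.baseChange (v.adicCompletion ℚ)).toAffine.Point →+ _).range.index =
        2 ^ M ∧
      Nat.card (Wd.kummerLocalConditionAt ((2 ^ M : ℕ) : ℤ) (v.adicCompletion ℚ)) = 2 ^ M := by
  have hd : ((NumberField.discr K : ℤ) : ℚ) ≠ 0 := by exact_mod_cast NumberField.discr_ne_zero K
  have hΔ' := Δ_neg_of_smul_quadraticTwist_eq W hd Wd hC hΔ
  have hg' := hasGoodReductionAtPrime_of_smul_quadraticTwist_eq W hK.1 hodd Wd hC hℓd hgoodℓ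
  have hF' := frobEqFrobInfty_of_smul_quadraticTwist_eq W hK Wd hC hℓ
  have hM' : M ≤ Zhang2014.kolyvaginIndex Wd 2 ℓ := by
    rwa [kolyvaginIndex_eq_of_smul_quadraticTwist_eq W hK.1 hodd Wd hC hℓ2 hℓd hgoodℓ 2]
  exact ⟨index_range_two_pow_eq Wd hΔ' hℓ2 hg' hF' hv hM',
    natCard_kummerLocalConditionAt_two_pow_eq Wd hΔ' hℓ2 hg' hF' hv hM'⟩

end Twin

end Summit.BirchSwinnertonDyer.BirchSwinnertonDyer.Theorems.GenusExact.TwinGrossPrimes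

end
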